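import Summits.ValiantsHypothesis.ValiantsHypothesis.Theorems.LacunarySymmetroidMatrixDescartesHalvingSweepRecursionArith
import Summits.ValiantsHypothesis.ValiantsHypothesis.Theorems.LacunarySymmetroidMatrixDescartesCensusNoBilinearLaw

/-!
# Crux `MatrixDescartes` (stmt-ValiantsHypothesis-18050), line `halving-sweep-sesqui-law` —
# the WINDOW of the halving recursion is load-bearing (kernel no-go for the unguarded recursion)

Line skeleton: ideator val-idea-2 (g0), `run/shared/lean/pub/ideators/val-idea-2/lines/line-halving-sweep-sesqui-law.lean`
r1 (sha16 `4a2515cbaafbeae4`).  Its `HalvingRecursion` is `∃ a c, ∀ m K k B₁ B₂, c (⌊log₂ m⌋+1) ≤ K + 1 → 0 < k ≤ K →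
ζ(m,k) ≤ B₁ → ζ(m,K+1−k) ≤ B₂ → ζ(m,K+1) ≤ 2 (B₂ + m + 2 (a m (B₁+B₂+m) + ((K+1)(m+1))^a))`; the guard
`c (⌊log₂ m⌋+1) ≤ K + 1` ("the window") is where the line's `GuardedWiggleLaw` is allowed to act.  A by-product of the
arithmetic of the stub `stub_recursionArith` (companion file `…HalvingSweepRecursionArith.lean`, p588640): the same
dyadic unrolling WITHOUT a window (`c = 0`, recursion at every `K ≥ 1`, Descartes base at `T = 2` letters) yields the
BILINEAR-IN-LOGS shape `ζ(m,K) ≤ 2 ^ ((12a+9)(⌊log₂ m⌋+1)(⌊log₂ K⌋+1))` (`posRootLawAt_bilinear_of_unguarded`: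
level bound `(3+8am)^j ((m+1) + 2m + 4am² + 4 (2^{j+1}(m+1))^a)` at `j = ⌊log₂ K⌋+1`, every factor a power of
`Y = 2^((⌊log₂m⌋+1)(⌊log₂K⌋+1))`), and that shape is REFUTED in the tree by the doubled kernel staircase
(`Census.noGo_bilinearLogLaw`, p583698).  Hence:

* `not_unguarded_halvingRecursion`: there is NO `a` for which the halving recursion holds unguarded (at every `K ≥ 1`);
* `one_le_window_of_halvingRecursionAt`: every witness `(a, c)` of the line's `HalvingRecursion` has `c ≥ 1` — the
  window hypothesis is load-bearing (critic-1's paper remark "the guard `c(log₂m+1) ≤ K+1` is what excludes the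
  staircase", now kernel), i.e. any proof of `stub_halvingStep` must genuinely use the guard of `GuardedWiggleLaw`.

Elementary given the two imported tree files; axioms `propext`, `Classical.choice`, `Quot.sound`.  This module imports
`…CensusNoBilinearLaw`, whose cone contains route-dependent modules; nothing is meant to be built on top of it.

HONEST FRAMING: a small NEGATIVE by-product (instrument tier) about the SHAPE of the line's recursion; it says nothing
about the guarded statements (`HalvingRecursion` with `c ≥ 1`, `GuardedWiggleLaw`, `HalfSweepIneq`, `SesquiLaw`), about
the crux `LacunarySymmetroid.MatrixDescartes`, Conjecture B or the doors; rung currency 18050 open → open; `VP ≠ VNP`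
is NOT proved and nothing here is progress on it.  No definitions, no named facts.
-/

-- `Summit.ValiantsHypothesis.ValiantsHypothesis.…` is the tree's mandated single-conjunct layout
-- (Sub = Summit), so the duplicated namespace component is intended.
set_option linter.dupNamespace false
set_option autoImplicit false

namespace Summit.ValiantsHypothesis.ValiantsHypothesis.Theorems.LacunarySymmetroidMatrixDescartes

open Summit.ValiantsHypothesis.ValiantsHypothesis.Theorems.MatrixDescartes.Negative (PosRootLawAt)
open scoped BigOperators

namespace HalvingSweep

/-- **Bilinear envelope.**  With `m + 1 ≤ 2^(L+1)` and the level bound of the UNGUARDED recursion (base `T = 2`) at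
`j = k + 1`, the positive-row bound `G` is at most `2 ^ ((12a+9)(L+1)(k+1))`: every factor is a power of
`Y = 2^((L+1)(k+1))` — `(3+8am)^(k+1) ≤ Y^(8a+3)`, `m + 1 ≤ Y`, `4 (2^(k+1)·2·(m+1))^a ≤ Y^(3a+2)`,
`2m ≤ Y²`, `4am² ≤ Y^(a+4)`. [folklore] -/
theorem envelope_bilinear (a m L k G : ℕ) (hm : m + 1 ≤ 2 ^ (L + 1))
    (hG : G ≤ (3 + 8 * a * m) ^ (k + 1) *
      ((m + 1) ^ (2 - 1) + (2 * m + 4 * a * m ^ 2 + 4 * (2 ^ (k + 1) * 2 * (m + 1)) ^ a))) :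
    G ≤ 2 ^ ((12 * a + 9) * (L + 1) * (k + 1)) := by
  obtain ⟨Y, hY⟩ : ∃ Y, Y = 2 ^ ((L + 1) * (k + 1)) := ⟨_, rfl⟩
  have hF1 : L + 1 ≤ (L + 1) * (k + 1) := Nat.le_mul_of_pos_right _ (Nat.succ_pos k)
  have hF2 : k + 1 ≤ (L + 1) * (k + 1) := Nat.le_mul_of_pos_left _ (Nat.succ_pos L)
  have hYpos : 0 < Y := by rw [hY]; exact Nat.two_pow_pos _
  have hY2 : 2 ≤ Y := by
    rw [hY]
    calc (2 : ℕ) = 2 ^ 1 := by norm_num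
      _ ≤ 2 ^ ((L + 1) * (k + 1)) := Nat.pow_le_pow_right (by norm_num) (le_trans (by omega) hF1)
  obtain ⟨U, hU⟩ : ∃ U, U = 2 ^ (L + 1) := ⟨_, rfl⟩
  rw [← hU] at hm
  have hU2 : 2 ≤ U := by
    rw [hU]
    calc (2 : ℕ) = 2 ^ 1 := by norm_num
      _ ≤ 2 ^ (L + 1) := Nat.pow_le_pow_right (by norm_num) (by omega)
  have hUY : U ≤ Y := by rw [hU, hY]; exact Nat.pow_le_pow_right (by norm_num) hF1
  have hVY : 2 ^ (k + 1) ≤ Y := by rw [hY]; exact Nat.pow_le_pow_right (by norm_num) hF2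
  have hUkY : U ^ (k + 1) = Y := by rw [hU, hY, ← pow_mul]
  have hm1Y : m + 1 ≤ Y := hm.trans hUY
  have hmY : m ≤ Y := by omega
  have hYle : ∀ {i i' : ℕ}, i ≤ i' → Y ^ i ≤ Y ^ i' := fun h => Nat.pow_le_pow_right hYpos h
  -- (1) the multiplier `(3 + 8am)^(k+1) ≤ Y^(8a+3)`
  have hR : 3 + 8 * a * m ≤ U ^ (8 * a + 3) := by
    have h1 : 3 + 8 * a ≤ 2 ^ (8 * a + 2) := by
      have := (Nat.lt_two_pow_self : 8 * a + 2 < 2 ^ (8 * a + 2))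
      omega
    have h2 : 2 ^ (8 * a + 2) ≤ U ^ (8 * a + 2) := Nat.pow_le_pow_left hU2 _
    calc 3 + 8 * a * m ≤ (3 + 8 * a) * U := by nlinarith [Nat.mul_le_mul_left (8 * a) hm, hU2]
      _ ≤ U ^ (8 * a + 2) * U := Nat.mul_le_mul_right _ (h1.trans h2)
      _ = U ^ (8 * a + 3) := by ring
  have hRk : (3 + 8 * a * m) ^ (k + 1) ≤ Y ^ (8 * a + 3) :=
    calc (3 + 8 * a * m) ^ (k + 1) ≤ (U ^ (8 * a + 3)) ^ (k + 1) := Nat.pow_le_pow_left hR _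
      _ = (U ^ (k + 1)) ^ (8 * a + 3) := by ring
      _ = Y ^ (8 * a + 3) := by rw [hUkY]
  -- (2) the terms of the bracket
  have h4Y : 4 ≤ Y ^ 2 :=
    calc (4 : ℕ) = 2 ^ 2 := by norm_num
      _ ≤ Y ^ 2 := Nat.pow_le_pow_left hY2 2
  have hD : (m + 1) ^ (2 - 1) ≤ Y ^ 1 := by
    rw [pow_one]
    simpa using hm1Y
  have hP : 4 * (2 ^ (k + 1) * 2 * (m + 1)) ^ a ≤ Y ^ (3 * a + 2) := by
    have h1 : 2 ^ (k + 1) * 2 * (m + 1) ≤ Y ^ 3 :=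
      calc 2 ^ (k + 1) * 2 * (m + 1) ≤ Y * Y * Y := Nat.mul_le_mul (Nat.mul_le_mul hVY hY2) hm1Y
        _ = Y ^ 3 := by ring
    calc 4 * (2 ^ (k + 1) * 2 * (m + 1)) ^ a ≤ Y ^ 2 * (Y ^ 3) ^ a :=
          Nat.mul_le_mul h4Y (Nat.pow_le_pow_left h1 _)
      _ = Y ^ (3 * a + 2) := by ring
  have h2m : 2 * m ≤ Y ^ 2 :=
    calc 2 * m ≤ Y * Y := Nat.mul_le_mul hY2 hmY
      _ = Y ^ 2 := (sq Y).symm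
  have h4am : 4 * a * m ^ 2 ≤ Y ^ (a + 4) := by
    have h1 : 4 * a ≤ 2 ^ (a + 2) := by
      have := (Nat.lt_two_pow_self : a < 2 ^ a).le
      calc 4 * a ≤ 4 * 2 ^ a := Nat.mul_le_mul_left 4 this
        _ = 2 ^ (a + 2) := by ring
    have h2 : 2 ^ (a + 2) ≤ Y ^ (a + 2) := Nat.pow_le_pow_left hY2 _
    calc 4 * a * m ^ 2 ≤ Y ^ (a + 2) * Y ^ 2 :=
          Nat.mul_le_mul (h1.trans h2) (Nat.pow_le_pow_left hmY 2)
      _ = Y ^ (a + 4) := by rw [← pow_add]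
  -- (3) assemble
  have hsum : (m + 1) ^ (2 - 1) + (2 * m + 4 * a * m ^ 2 + 4 * (2 ^ (k + 1) * 2 * (m + 1)) ^ a) ≤
      Y ^ (4 * a + 6) :=
    calc (m + 1) ^ (2 - 1) + (2 * m + 4 * a * m ^ 2 + 4 * (2 ^ (k + 1) * 2 * (m + 1)) ^ a)
        ≤ Y ^ (4 * a + 4) + (Y ^ (4 * a + 4) + Y ^ (4 * a + 4) + Y ^ (4 * a + 4)) :=
          Nat.add_le_add (hD.trans (hYle (by omega)))
            (Nat.add_le_add (Nat.add_le_add (h2m.trans (hYle (by omega))) (h4am.trans (hYle (by omega))))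
              (hP.trans (hYle (by omega))))
      _ = 4 * Y ^ (4 * a + 4) := by ring
      _ ≤ Y ^ 2 * Y ^ (4 * a + 4) := Nat.mul_le_mul_right _ h4Y
      _ = Y ^ (4 * a + 6) := by rw [← pow_add]; ring_nf
  calc G ≤ (3 + 8 * a * m) ^ (k + 1) *
        ((m + 1) ^ (2 - 1) + (2 * m + 4 * a * m ^ 2 + 4 * (2 ^ (k + 1) * 2 * (m + 1)) ^ a)) := hG
    _ ≤ Y ^ (8 * a + 3) * Y ^ (4 * a + 6) := Nat.mul_le_mul hRk hsum
    _ = Y ^ (12 * a + 9) := by rw [← pow_add]; ring_nf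
    _ = 2 ^ ((12 * a + 9) * (L + 1) * (k + 1)) := by rw [hY]; ring

/-- **The unguarded halving recursion forces the bilinear-in-logs law.**  If for some `a` the recursion
`ζ(m,K+1) ≤ 2 (B₂ + m + 2 (a m (B₁+B₂+m) + ((K+1)(m+1))^a))` holds at EVERY `K ≥ 1` (no window), then
`ζ(m,K) ≤ 2 ^ ((12a+9)(⌊log₂ m⌋+1)(⌊log₂ K⌋+1))` for all formats: the dyadic unrolling of the companion file
(`level_bound` with threshold `T = 2`, Descartes base `(m+1)`) and the bilinear envelope; `K = 0` has no zeros.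
[folklore] -/
theorem posRootLawAt_bilinear_of_unguarded (a : ℕ)
    (hrec : ∀ (m K k B₁ B₂ : ℕ), 0 < k → k ≤ K →
      PosRootLawAt m k B₁ → PosRootLawAt m (K + 1 - k) B₂ →
      PosRootLawAt m (K + 1) (2 * (B₂ + m + 2 * (a * m * (B₁ + B₂ + m) + ((K + 1) * (m + 1)) ^ a))))
    (m K : ℕ) : PosRootLawAt m K (2 ^ ((12 * a + 9) * (Nat.log 2 m + 1) * (Nat.log 2 K + 1))) := by
  rcases Nat.eq_zero_or_pos K with rfl | hK
  · -- the `K = 0` format: the empty pencil is the constant matrix `0`; a constant determinant has no zeros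
    intro d S _
    have h0 : (∑ l : Fin 0, ((Polynomial.X : Polynomial ℝ) ^ d l) • (S l).map Polynomial.C) =
        (0 : Matrix (Fin m) (Fin m) ℝ).map Polynomial.C := by simp
    rw [h0, ← RingHom.mapMatrix_apply, ← RingHom.map_det, Polynomial.roots_C]
    simp
  obtain ⟨G, hG, hGle⟩ := level_bound a 0 m 2 (Nat.zero_le _) le_rfl
    (fun K k B₁ B₂ _ => hrec m K k B₁ B₂) (Nat.log 2 K + 1)
  have hKle : K ≤ 2 ^ (Nat.log 2 K + 1) * 2 :=
    calc K ≤ 2 ^ (Nat.log 2 K + 1) := (Nat.lt_pow_succ_log_self one_lt_two K).le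
      _ ≤ 2 ^ (Nat.log 2 K + 1) * 2 := Nat.le_mul_of_pos_right _ (by norm_num)
  exact fun d S hS => (hG K hK hKle d S hS).trans
    (envelope_bilinear a m (Nat.log 2 m) (Nat.log 2 K) G (Nat.lt_pow_succ_log_self one_lt_two m) hGle)

/-- **NO-GO: the halving recursion cannot hold unguarded.**  There is no `a` for which
`ζ(m,K+1) ≤ 2 (B₂ + m + 2 (a m (B₁+B₂+m) + ((K+1)(m+1))^a))` follows from `ζ(m,k) ≤ B₁`, `ζ(m,K+1−k) ≤ B₂` at every
`K ≥ 1`, `0 < k ≤ K`: it would give the bilinear-in-logs law (`posRootLawAt_bilinear_of_unguarded`), refuted by the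
doubled kernel staircase (`Census.noGo_bilinearLogLaw`). [folklore given the tree's no-go] -/
theorem not_unguarded_halvingRecursion :
    ¬ ∃ a : ℕ, ∀ (m K k B₁ B₂ : ℕ), 0 < k → k ≤ K →
      PosRootLawAt m k B₁ → PosRootLawAt m (K + 1 - k) B₂ →
      PosRootLawAt m (K + 1) (2 * (B₂ + m + 2 * (a * m * (B₁ + B₂ + m) + ((K + 1) * (m + 1)) ^ a))) := by
  rintro ⟨a, hrec⟩
  exact Census.noGo_bilinearLogLaw ⟨12 * a + 9, posRootLawAt_bilinear_of_unguarded a hrec⟩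

/-- **The window is load-bearing.**  In the line's `HalvingRecursion`
(`∃ a c, ∀ m K k B₁ B₂, c (⌊log₂ m⌋+1) ≤ K + 1 → …`), every witness has `c ≥ 1`: with `c = 0` the guard is vacuous
and `not_unguarded_halvingRecursion` applies.  (So a proof of the line's `stub_halvingStep` must use the guard of
`GuardedWiggleLaw`; nothing is claimed about `c ≥ 1`.) [folklore given the tree's no-go] -/
theorem one_le_window_of_halvingRecursionAt (a c : ℕ)
    (h : ∀ (m K k B₁ B₂ : ℕ), c * (Nat.log 2 m + 1) ≤ K + 1 → 0 < k → k ≤ K →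
      PosRootLawAt m k B₁ → PosRootLawAt m (K + 1 - k) B₂ →
      PosRootLawAt m (K + 1) (2 * (B₂ + m + 2 * (a * m * (B₁ + B₂ + m) + ((K + 1) * (m + 1)) ^ a)))) :
    1 ≤ c := by
  by_contra hc
  have hc0 : c = 0 := by omega
  subst hc0
  exact not_unguarded_halvingRecursion
    ⟨a, fun m K k B₁ B₂ hk hkK => h m K k B₁ B₂ (by simp) hk hkK⟩

end HalvingSweep

end Summit.ValiantsHypothesis.ValiantsHypothesis.Theorems.LacunarySymmetroidMatrixDescartes
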